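import Summits.Ventures.HodgeRepro2.T5CartanU11

/-!
# T5CentreU11 — U(1,1) = Z · SU(1,1) with Z ∩ SU(1,1) = {±1}, kernel-checked

Support file for sub-step N4.3 = (R3) of the Tier-5 discharge of (N) (route/T5-N4-p5.md,
owner p5), written by seat p1 of the blind cell pub-hodge-repro2.

README §8(d) declaration: uses an L-value-free non-vanishing device: **no** — matrix algebra in
support of (N4.3.P2′)/(P3), a line on the record since N4.3 v1 (2026-08-25T01:25:26Z, STATUS
l. 818).

## What is proved

The group-theoretic sentence of (N4.3.P2′), «H_j = U(1,1) ⊃ H_j¹ := SU(1,1) and Z_j ≅ U(1) the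
centre; H_j = H_j¹ · Z_j with H_j¹ ∩ Z_j = {±1}», and (P3)'s «Z_j × SU(1,1) → U(1,1) is 2 : 1»,
for U(1,1) = {g : gᴴ J g = J} of `T5UnitaryBound`:

* `memU11_smul_one` / `memU11_smul` — unit scalars z·1 lie in U(1,1), and U(1,1) is closed under
  unit-scalar multiples;
* `exists_smul_det_one` — every g ∈ U(1,1) is z · h with |z| = 1, h ∈ U(1,1) and det h = 1
  (z = a square root of det g, which has |det g| = 1 by `T5UnitaryBound.norm_det`): U(1,1) = Z · SU(1,1);
* `smul_one_det_one_iff` — z · 1 ∈ SU(1,1) iff z = ±1: Z ∩ SU(1,1) = {±1};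
* `smul_eq_smul_iff_of_det_one` — z · h = z′ · h′ with det h = det h′ = 1 iff z′ = ±z and
  h′ = ±h accordingly: the fibres of Z × SU(1,1) → U(1,1) have exactly two points.

## What is NOT formalised (honest scope)

The measure-theoretic consequence (∫_{U(1,1)} = (vol Z_j / 2) ∫_{SU(1,1)}), Haar measures,
the isomorphism SU(1,1) ≅ SL(2,ℝ), anything representation-theoretic.  Mathlib only (plus the
cell's own `T5UnitaryBound` / `T5CartanU11`); no new definitions.
-/

namespace Summit.Ventures.HodgeRepro2.T5CentreU11

open Complex
open Summit.Ventures.HodgeRepro2.T5UnitaryBound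
open Summit.Ventures.HodgeRepro2.T5CartanU11

/-- A unit scalar z · 1 lies in U(1,1) (the centre Z ≅ U(1)). -/
theorem memU11_smul_one {z : ℂ} (hz : ‖z‖ = 1) :
    MemU11 (z • (1 : Matrix (Fin 2) (Fin 2) ℂ)) := by
  have h1 : z * star z = 1 := by
    rw [Complex.star_def, Complex.mul_conj', hz]; simp
  unfold MemU11
  rw [Matrix.conjTranspose_smul, Matrix.conjTranspose_one, Matrix.smul_mul, Matrix.one_mul,
    Matrix.mul_smul, Matrix.mul_one, smul_smul, h1, one_smul]

/-- U(1,1) is closed under multiplication by unit scalars. -/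
theorem memU11_smul {z : ℂ} (hz : ‖z‖ = 1) {h : Matrix (Fin 2) (Fin 2) ℂ} (hh : MemU11 h) :
    MemU11 (z • h) := by
  have : z • h = z • (1 : Matrix (Fin 2) (Fin 2) ℂ) * h := by
    rw [Matrix.smul_mul, Matrix.one_mul]
  rw [this]
  exact memU11_mul (memU11_smul_one hz) hh

/-- det(z · 1) = z² for 2 × 2 matrices. -/
theorem det_smul_one (z : ℂ) : (z • (1 : Matrix (Fin 2) (Fin 2) ℂ)).det = z ^ 2 := by
  rw [Matrix.det_smul, Matrix.det_one, mul_one, Fintype.card_fin]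

/-- det(z · h) = z² · det h for 2 × 2 matrices. -/
theorem det_smul (z : ℂ) (h : Matrix (Fin 2) (Fin 2) ℂ) : (z • h).det = z ^ 2 * h.det := by
  rw [Matrix.det_smul, Fintype.card_fin]

/-- The unit square root of det g: z := exp(i · arg(det g)/2) has |z| = 1 and z² = det g
for g ∈ U(1,1) (|det g| = 1). -/
theorem exists_unit_sq_eq_det {g : Matrix (Fin 2) (Fin 2) ℂ} (hg : MemU11 g) :
    ∃ z : ℂ, ‖z‖ = 1 ∧ z ^ 2 = g.det := by
  refine ⟨Complex.exp (((g.det.arg / 2 : ℝ) : ℂ) * I), Complex.norm_exp_ofReal_mul_I _, ?_⟩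
  rw [← Complex.exp_nat_mul]
  have h : ((2 : ℕ) : ℂ) * (((g.det.arg / 2 : ℝ) : ℂ) * I) = ((g.det.arg : ℝ) : ℂ) * I := by
    push_cast; ring
  rw [h]
  have h2 := Complex.norm_mul_exp_arg_mul_I g.det
  rw [norm_det hg, Complex.ofReal_one, one_mul] at h2
  exact h2

/-- **U(1,1) = Z · SU(1,1)**: every g ∈ U(1,1) is z · h with |z| = 1, h ∈ U(1,1), det h = 1. -/
theorem exists_smul_det_one {g : Matrix (Fin 2) (Fin 2) ℂ} (hg : MemU11 g) :
    ∃ (z : ℂ) (h : Matrix (Fin 2) (Fin 2) ℂ), ‖z‖ = 1 ∧ MemU11 h ∧ h.det = 1 ∧ g = z • h := by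
  obtain ⟨z, hz, hz2⟩ := exists_unit_sq_eq_det hg
  have hz0 : z ≠ 0 := by
    intro h0; rw [h0, norm_zero] at hz; exact zero_ne_one hz
  have hzinv : ‖z⁻¹‖ = 1 := by rw [norm_inv, hz, inv_one]
  refine ⟨z, z⁻¹ • g, hz, memU11_smul hzinv hg, ?_, ?_⟩
  · rw [det_smul, inv_pow, hz2, inv_mul_cancel₀]
    rw [← hz2]; exact pow_ne_zero 2 hz0
  · rw [smul_smul, mul_inv_cancel₀ hz0, one_smul]

/-- **Z ∩ SU(1,1) = {±1}**: the unit scalar z · 1 has determinant 1 iff z = ±1. -/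
theorem smul_one_det_one_iff {z : ℂ} :
    (z • (1 : Matrix (Fin 2) (Fin 2) ℂ)).det = 1 ↔ z = 1 ∨ z = -1 := by
  rw [det_smul_one, sq_eq_one_iff]

/-- The fibres of Z × SU(1,1) → U(1,1) have exactly two points: z · h = z′ · h′ with
det h = det h′ = 1 forces z′ = z (and then h′ = h) or z′ = −z (and then h′ = −h). -/
theorem smul_eq_smul_iff_of_det_one {z z' : ℂ} {h h' : Matrix (Fin 2) (Fin 2) ℂ}
    (hz : z ≠ 0) (hh : h.det = 1) (hh' : h'.det = 1) :
    z • h = z' • h' ↔ (z' = z ∧ h' = h) ∨ (z' = -z ∧ h' = -h) := by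
  constructor
  · intro e
    have hd : z ^ 2 = z' ^ 2 := by
      have := congrArg Matrix.det e
      rwa [det_smul, det_smul, hh, hh', mul_one, mul_one] at this
    rcases sq_eq_sq_iff_eq_or_eq_neg.1 hd with hzz | hzz
    · left
      refine ⟨hzz.symm, ?_⟩
      rw [hzz] at e
      exact (smul_right_injective _ (by rw [← hzz]; exact hz) e).symm
    · right
      refine ⟨by rw [hzz, neg_neg], ?_⟩
      rw [hzz, neg_smul, ← smul_neg] at e
      have hz' : z' ≠ 0 := by
        intro h0; rw [h0, neg_zero] at hzz; exact hz hzz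
      exact (smul_right_injective (Matrix (Fin 2) (Fin 2) ℂ) hz' e).symm
  · rintro (⟨rfl, rfl⟩ | ⟨rfl, rfl⟩)
    · rfl
    · rw [neg_smul, smul_neg, neg_neg]

end Summit.Ventures.HodgeRepro2.T5CentreU11
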